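import Mathlib.Analysis.SpecialFunctions.Pow.Real
import Mathlib.Analysis.SpecialFunctions.Log.Basic
import Mathlib.Analysis.SpecialFunctions.Exp
import Mathlib.Algebra.Order.BigOperators.Ring.Finset
import HarnessLib

/-!
# Barrier (Schanuel) `NesterenkoModularScope`: growth bookkeeping for LNM 1752 Ch. 3 Theorem 5.1 — proofs only

`Literature/Barriers/Schanuel/NesterenkoModularScopeMeasureGrowth.lean` — proofs only, pure real
analysis. The induction of LNM 1752 Ch. 3 §5 (proof of Theorem 5.1, pp. 42–46) runs on the functions
`f_r(T) = T^{4/(4−r)} (log T)^{8r/(4−r)}` (`r = 1, 2, 3`); everything it uses about them is an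
instance of the following facts on `x ↦ x^a (log x)^b` (`a ≥ 1`, `b ≥ 0`, `x ≥ e`), proved here once:

* monotonicity, `x ≤ x^a (log x)^b`, and `(cx)^a (log (cx))^b ≤ c^a (1 + log c)^b x^a (log x)^b`;
* *superadditivity* `∑ k_j x_j^a (log x_j)^b ≤ X^a (log X)^b`, `X = ∑ k_j x_j` (from the
  monotonicity of `x^{a−1} (log x)^b`) — the step "`∑ k_j t(𝔭_j)^{4/(4−r)}(1 + log t(𝔭_j))^{8r/(4−r)}
  ≤ c t(I)^{4/(4−r)} (1 + log t(I))^{8r/(4−r)}`" of p. 43;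
* the exponent identities behind (27)–(29) and the last display of p. 45:
  `T^{(5−r)/(4−r)} (log T)^{8/(4−r)} ≤ f_r(T)`, the bound for `T L log² L` under (23), and
  `f_{r−1}(λ⁵ T^{(5−r)/(4−r)} (log T)^{8/(4−r)}) ≤ 12⁸ λ^{10} f_r(T)`.

## References

* [NesterenkoPhilippon2001] LNM 1752 (2001), Ch. 3 §5, proof of Theorem 5.1 (pp. 42–46).
-/

noncomputable section

open Real Finset

namespace Literature.Barriers.Schanuel

/-! ### `x ↦ x^a (log x)^b` -/

/-- `1 ≤ log x` for `x ≥ e`. [folklore] -/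
theorem one_le_log_of_exp_one_le {x : ℝ} (hx : exp 1 ≤ x) : 1 ≤ log x := by
  rw [le_log_iff_exp_le (by linarith [exp_pos 1])]
  exact hx

/-- `x^a (log x)^b ≥ 0` for `x ≥ 1`. [folklore] -/
theorem growth_nonneg {a b x : ℝ} (hx : 1 ≤ x) : 0 ≤ x ^ a * log x ^ b :=
  mul_nonneg (rpow_nonneg (by linarith) a) (rpow_nonneg (log_nonneg hx) b)

/-- `x^a (log x)^b > 0` for `x > 1`. [folklore] -/
theorem growth_pos {a b x : ℝ} (hx : 1 < x) : 0 < x ^ a * log x ^ b :=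
  mul_pos (rpow_pos_of_pos (by linarith) a) (rpow_pos_of_pos (log_pos hx) b)

/-- Monotonicity of `x^a (log x)^b` on `[1, ∞)` (`a, b ≥ 0`). [folklore] -/
theorem growth_mono {a b x y : ℝ} (ha : 0 ≤ a) (hb : 0 ≤ b) (hx : 1 ≤ x) (hxy : x ≤ y) :
    x ^ a * log x ^ b ≤ y ^ a * log y ^ b :=
  mul_le_mul (rpow_le_rpow (by linarith) hxy ha)
    (rpow_le_rpow (log_nonneg hx) (log_le_log (by linarith) hxy) hb)
    (rpow_nonneg (log_nonneg hx) b) (rpow_nonneg (by linarith) a)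

/-- Monotonicity of `x^a (log x)^b / x = x^{a−1} (log x)^b` on `[1, ∞)` (`a ≥ 1`, `b ≥ 0`). [folklore] -/
theorem growth_div_mono {a b x y : ℝ} (ha : 1 ≤ a) (hb : 0 ≤ b) (hx : 1 ≤ x) (hxy : x ≤ y) :
    x ^ a * log x ^ b / x ≤ y ^ a * log y ^ b / y := by
  have hx0 : 0 < x := by linarith
  have hy0 : 0 < y := by linarith
  rw [show x ^ a * log x ^ b / x = x ^ (a - 1) * log x ^ b by
        rw [rpow_sub_one hx0.ne']; ring,
      show y ^ a * log y ^ b / y = y ^ (a - 1) * log y ^ b by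
        rw [rpow_sub_one hy0.ne']; ring]
  exact growth_mono (by linarith) hb hx hxy

/-- **Superadditivity**: if `k_j ≥ 0`, `x_j ≥ 1` and `x_j ≤ X = ∑ k_i x_i` for all `j`, then
`∑ k_j x_j^a (log x_j)^b ≤ X^a (log X)^b` (`a ≥ 1`, `b ≥ 0`): `f(x_j) = x_j · f(x_j)/x_j ≤ x_j f(X)/X`.
[cite: NesterenkoPhilippon2001, Ch. 3 §5 (p. 43)] -/
theorem growth_superadditive {ι : Type*} (s : Finset ι) (k x : ι → ℝ) {a b : ℝ} (ha : 1 ≤ a)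
    (hb : 0 ≤ b) (hk : ∀ j ∈ s, 0 ≤ k j) (hx : ∀ j ∈ s, 1 ≤ x j)
    (hX : ∀ j ∈ s, x j ≤ ∑ i ∈ s, k i * x i) :
    ∑ j ∈ s, k j * (x j ^ a * log (x j) ^ b) ≤
      (∑ i ∈ s, k i * x i) ^ a * log (∑ i ∈ s, k i * x i) ^ b := by
  rcases s.eq_empty_or_nonempty with rfl | hne
  · simp [zero_rpow (by linarith : a ≠ 0)]
  obtain ⟨j₀, hj₀⟩ := hne
  set X := ∑ i ∈ s, k i * x i with hXdef
  have hX1 : 1 ≤ X := (hx j₀ hj₀).trans (hX j₀ hj₀)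
  have hX0 : 0 < X := by linarith
  have key : ∀ j ∈ s, k j * (x j ^ a * log (x j) ^ b) ≤ (k j * x j) * (X ^ a * log X ^ b / X) := by
    intro j hj
    have hxj : 0 < x j := by linarith [hx j hj]
    have h1 : x j ^ a * log (x j) ^ b / x j ≤ X ^ a * log X ^ b / X :=
      growth_div_mono ha hb (hx j hj) (hX j hj)
    have h2 : x j ^ a * log (x j) ^ b = x j * (x j ^ a * log (x j) ^ b / x j) := by
      field_simp
    rw [h2, ← mul_assoc]
    exact mul_le_mul_of_nonneg_left h1 (mul_nonneg (hk j hj) hxj.le)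
  calc ∑ j ∈ s, k j * (x j ^ a * log (x j) ^ b)
      ≤ ∑ j ∈ s, (k j * x j) * (X ^ a * log X ^ b / X) := Finset.sum_le_sum key
    _ = X * (X ^ a * log X ^ b / X) := by rw [← Finset.sum_mul]
    _ = X ^ a * log X ^ b := by field_simp

/-- `(cx)^a (log (cx))^b ≤ c^a (1 + log c)^b · x^a (log x)^b` for `c ≥ 1`, `x ≥ e` (`b ≥ 0`).
[folklore] -/
theorem growth_mul_le {a b c x : ℝ} (hb : 0 ≤ b) (hc : 1 ≤ c) (hx : exp 1 ≤ x) :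
    (c * x) ^ a * log (c * x) ^ b ≤ (c ^ a * (1 + log c) ^ b) * (x ^ a * log x ^ b) := by
  have hx0 : 0 < x := lt_of_lt_of_le (exp_pos 1) hx
  have hx1 : 1 ≤ x := le_trans (by linarith [add_one_le_exp (1 : ℝ)]) hx
  have hlx : 1 ≤ log x := one_le_log_of_exp_one_le hx
  have hlc : 0 ≤ log c := log_nonneg hc
  have hlog : log (c * x) ≤ (1 + log c) * log x := by
    rw [log_mul (by linarith) hx0.ne']
    nlinarith
  rw [mul_rpow (by linarith) hx0.le]
  have h2 : log (c * x) ^ b ≤ ((1 + log c) * log x) ^ b :=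
    rpow_le_rpow (log_nonneg (one_le_mul_of_one_le_of_one_le hc hx1)) hlog hb
  rw [mul_rpow (by linarith) (by linarith)] at h2
  calc c ^ a * x ^ a * log (c * x) ^ b ≤ c ^ a * x ^ a * ((1 + log c) ^ b * log x ^ b) :=
        mul_le_mul_of_nonneg_left h2 (by positivity)
    _ = (c ^ a * (1 + log c) ^ b) * (x ^ a * log x ^ b) := by ring

/-- `x ≤ x^a (log x)^b` for `x ≥ e`, `a ≥ 1`, `b ≥ 0`. [folklore] -/
theorem le_growth {a b x : ℝ} (ha : 1 ≤ a) (hb : 0 ≤ b) (hx : exp 1 ≤ x) : x ≤ x ^ a * log x ^ b := by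
  have hx1 : 1 ≤ x := le_trans (by linarith [add_one_le_exp (1 : ℝ)]) hx
  have h1 : x ≤ x ^ a := by
    conv_lhs => rw [← rpow_one x]
    exact rpow_le_rpow_of_exponent_le hx1 ha
  have h2 : 1 ≤ log x ^ b := one_le_rpow (one_le_log_of_exp_one_le hx) hb
  calc x = x * 1 := (mul_one x).symm
    _ ≤ x ^ a * log x ^ b := mul_le_mul h1 h2 zero_le_one (by linarith)

/-- `x^{a} (log x)^{b} ≤ x^{a'} (log x)^{b'}` for `x ≥ e` when `a ≤ a'`, `b ≤ b'`. [folklore] -/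
theorem growth_le_growth_of_exponent_le {a a' b b' x : ℝ} (hx : exp 1 ≤ x) (ha : a ≤ a')
    (hb : b ≤ b') : x ^ a * log x ^ b ≤ x ^ a' * log x ^ b' := by
  have hx1 : 1 ≤ x := le_trans (by linarith [add_one_le_exp (1 : ℝ)]) hx
  have hl1 : 1 ≤ log x := one_le_log_of_exp_one_le hx
  exact mul_le_mul (rpow_le_rpow_of_exponent_le hx1 ha) (rpow_le_rpow_of_exponent_le hl1 hb)
    (by positivity) (by positivity)

/-! ### The exponents of Theorem 5.1 -/

/-- For `r ≤ 3`: `4 − r > 0` as a real number. [folklore] -/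
theorem four_sub_pos {r : ℕ} (hr : r ≤ 3) : (0 : ℝ) < 4 - r := by
  have : (r : ℝ) ≤ 3 := by exact_mod_cast hr
  linarith

/-- `4/(4−r) ≥ 1` and `8r/(4−r) ≥ 0` for `r ≤ 3`. [folklore] -/
theorem exponents_le {r : ℕ} (hr : r ≤ 3) :
    (1 : ℝ) ≤ 4 / (4 - r) ∧ (0 : ℝ) ≤ 8 * r / (4 - r) := by
  have h4 := four_sub_pos hr
  constructor
  · rw [le_div_iff₀ h4]; linarith [(Nat.cast_nonneg r : (0 : ℝ) ≤ r)]
  · positivity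

/-- `f_r(T) ≥ T ≥ e > 1` for `T ≥ e`. [folklore] -/
theorem le_f {r : ℕ} (hr : r ≤ 3) {T : ℝ} (hT : exp 1 ≤ T) :
    T ≤ T ^ ((4 : ℝ) / (4 - r)) * log T ^ ((8 : ℝ) * r / (4 - r)) :=
  le_growth (exponents_le hr).1 (exponents_le hr).2 hT

/-- `f_r(T) ≥ T^{4/3}` for `T ≥ e`, `1 ≤ r ≤ 3`. [folklore] -/
theorem rpow_four_thirds_le_f {r : ℕ} (hr1 : 1 ≤ r) (hr : r ≤ 3) {T : ℝ} (hT : exp 1 ≤ T) :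
    T ^ ((4 : ℝ) / 3) ≤ T ^ ((4 : ℝ) / (4 - r)) * log T ^ ((8 : ℝ) * r / (4 - r)) := by
  have h4 := four_sub_pos hr
  have hT1 : 1 ≤ T := le_trans (by linarith [add_one_le_exp (1 : ℝ)]) hT
  have hr' : (1 : ℝ) ≤ r := by exact_mod_cast hr1
  have h1 : T ^ ((4 : ℝ) / 3) ≤ T ^ ((4 : ℝ) / (4 - r)) := by
    refine rpow_le_rpow_of_exponent_le hT1 ?_
    rw [div_le_div_iff₀ (by norm_num) h4]; nlinarith
  have h2 : 1 ≤ log T ^ ((8 : ℝ) * r / (4 - r)) :=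
    one_le_rpow (one_le_log_of_exp_one_le hT) (exponents_le hr).2
  calc T ^ ((4 : ℝ) / 3) = T ^ ((4 : ℝ) / 3) * 1 := (mul_one _).symm
    _ ≤ _ := mul_le_mul h1 h2 zero_le_one (by positivity)

/-- `g_r(T) = T^{(5−r)/(4−r)} (log T)^{8/(4−r)} ≤ f_r(T)` for `T ≥ e`, `1 ≤ r ≤ 3`
("In the case … (29)": `(5−r)/(4−r) ≤ 4/(4−r)` and `8/(4−r) ≤ 8r/(4−r)`).
[cite: NesterenkoPhilippon2001, Ch. 3 §5 (29) (p. 45)] -/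
theorem g_le_f {r : ℕ} (hr1 : 1 ≤ r) (hr : r ≤ 3) {T : ℝ} (hT : exp 1 ≤ T) :
    T ^ (((5 : ℝ) - r) / (4 - r)) * log T ^ ((8 : ℝ) / (4 - r)) ≤
      T ^ ((4 : ℝ) / (4 - r)) * log T ^ ((8 : ℝ) * r / (4 - r)) := by
  have h4 := four_sub_pos hr
  have hr' : (1 : ℝ) ≤ r := by exact_mod_cast hr1
  refine growth_le_growth_of_exponent_le hT ?_ ?_
  · exact div_le_div_of_nonneg_right (by linarith) h4.le
  · exact div_le_div_of_nonneg_right (by linarith) h4.le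

/-- `g_r(T) ≥ T ≥ e` for `T ≥ e` (`r ≤ 3`). [folklore] -/
theorem le_g {r : ℕ} (hr : r ≤ 3) {T : ℝ} (hT : exp 1 ≤ T) :
    T ≤ T ^ (((5 : ℝ) - r) / (4 - r)) * log T ^ ((8 : ℝ) / (4 - r)) := by
  have h4 := four_sub_pos hr
  refine le_growth ?_ (by positivity) hT
  rw [le_div_iff₀ h4]; linarith

/-- **The bound behind "≤ λ⁵ T^{(5−r)/(4−r)} (log T)^{8/(4−r)}" (p. 45)**: if
`L⁴ ≤ λ¹² f_r(T)/γ₂` ((23), (27)), `L ≥ 1`, `λ ≥ 1`, `T ≥ e` and `log T ≥ 5 log λ + |log γ₂|`, then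
`T · L · (log L)² ≤ 64 λ³ γ₂^{−1/4} · T^{(5−r)/(4−r)} (log T)^{8/(4−r)}`.
[cite: NesterenkoPhilippon2001, Ch. 3 §5 (27) and the display before (29) (p. 45)] -/
theorem T_mul_L_mul_log_sq_le {r : ℕ} (hr1 : 1 ≤ r) (hr : r ≤ 3) {T L lam γ₂ : ℝ} (hγ₂ : 0 < γ₂)
    (hlam : 1 ≤ lam) (hT : exp 1 ≤ T) (hlogT : 5 * log lam + |log γ₂| ≤ log T) (hL : 1 ≤ L)
    (hL4 : L ^ 4 ≤ lam ^ 12 * (T ^ ((4 : ℝ) / (4 - r)) * log T ^ ((8 : ℝ) * r / (4 - r))) / γ₂) :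
    T * L * log L ^ 2 ≤ 64 * lam ^ 3 * γ₂ ^ (-(1 / 4 : ℝ)) *
      (T ^ (((5 : ℝ) - r) / (4 - r)) * log T ^ ((8 : ℝ) / (4 - r))) := by
  have h4 := four_sub_pos hr
  have hr' : (1 : ℝ) ≤ r := by exact_mod_cast hr1
  have hr3 : (r : ℝ) ≤ 3 := by exact_mod_cast hr
  have hT0 : 0 < T := lt_of_lt_of_le (exp_pos 1) hT
  have hT1 : 1 ≤ T := le_trans (by linarith [add_one_le_exp (1 : ℝ)]) hT
  have hlT : 1 ≤ log T := one_le_log_of_exp_one_le hT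
  have hlam0 : 0 < lam := by linarith
  have hllam : 0 ≤ log lam := log_nonneg hlam
  set a : ℝ := 4 / (4 - r) with ha
  set b : ℝ := 8 * r / (4 - r) with hb
  have ha0 : 1 ≤ a := (exponents_le hr).1
  have ha4 : a ≤ 4 := by rw [ha, div_le_iff₀ h4]; nlinarith
  have hb0 : 0 ≤ b := (exponents_le hr).2
  have hb24 : b ≤ 24 := by rw [hb, div_le_iff₀ h4]; nlinarith
  set f : ℝ := T ^ a * log T ^ b with hf
  have hf1 : 1 ≤ f := hT1.trans (le_f hr hT)
  have hf0 : 0 < f := by linarith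
  -- `log L ≤ 8 log T`
  have hlogf : log f ≤ 28 * log T := by
    rw [hf, log_mul (rpow_pos_of_pos hT0 a).ne' (rpow_pos_of_pos (by linarith) b).ne',
      log_rpow hT0, log_rpow (by linarith)]
    have hll : log (log T) ≤ log T := by
      have := log_le_sub_one_of_pos (show 0 < log T by linarith)
      linarith
    have hll0 : 0 ≤ log (log T) := log_nonneg hlT
    nlinarith
  have hL0 : 0 < L := by linarith
  have hlogL : log L ≤ 8 * log T := by
    have h1 : 4 * log L = log (L ^ 4) := by rw [log_pow]; norm_num
    have h2 : log (L ^ 4) ≤ log (lam ^ 12 * f / γ₂) := log_le_log (by positivity) hL4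
    have h3 : log (lam ^ 12 * f / γ₂) = 12 * log lam + log f - log γ₂ := by
      rw [log_div (by positivity) hγ₂.ne', log_mul (by positivity) hf0.ne', log_pow]; norm_num
    have h5 : -log γ₂ ≤ |log γ₂| := neg_le_abs _
    have h6 : 0 ≤ |log γ₂| := abs_nonneg _
    linarith
  have hlogL0 : 0 ≤ log L := log_nonneg hL
  have hlogL2 : log L ^ 2 ≤ 64 * log T ^ 2 := by nlinarith
  -- `L ≤ (λ¹² f / γ₂)^{1/4} = λ³ γ₂^{-1/4} T^{a/4} (log T)^{b/4}`
  have hLle : L ≤ lam ^ 3 * γ₂ ^ (-(1 / 4 : ℝ)) * (T ^ (a / 4) * log T ^ (b / 4)) := by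
    have h1 : L = (L ^ 4) ^ (1 / 4 : ℝ) := by
      rw [← rpow_natCast, ← rpow_mul hL0.le]; norm_num
    have h2 : (L ^ 4) ^ (1 / 4 : ℝ) ≤ (lam ^ 12 * f / γ₂) ^ (1 / 4 : ℝ) :=
      rpow_le_rpow (by positivity) hL4 (by norm_num)
    have h3 : (lam ^ 12 * f / γ₂) ^ (1 / 4 : ℝ) =
        lam ^ 3 * γ₂ ^ (-(1 / 4 : ℝ)) * (T ^ (a / 4) * log T ^ (b / 4)) := by
      rw [div_eq_mul_inv, mul_rpow (by positivity) (inv_nonneg.mpr hγ₂.le),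
        mul_rpow (by positivity) hf0.le, hf, mul_rpow (rpow_nonneg hT0.le a)
        (rpow_nonneg (by linarith) b), ← rpow_mul hT0.le, ← rpow_mul (by linarith : 0 ≤ log T),
        inv_rpow hγ₂.le, ← rpow_neg hγ₂.le,
        show (lam ^ 12 : ℝ) ^ (1 / 4 : ℝ) = lam ^ 3 by
          rw [← rpow_natCast, ← rpow_mul hlam0.le]; norm_num]
      ring_nf
    rw [h1]
    exact h2.trans_eq h3
  -- assemble: `T L log²L ≤ T · λ³γ₂^{-1/4} T^{a/4}(log T)^{b/4} · 64 log²T`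
  have hprod : T * (T ^ (a / 4) * log T ^ (b / 4)) * log T ^ 2 =
      T ^ (((5 : ℝ) - r) / (4 - r)) * log T ^ ((8 : ℝ) / (4 - r)) := by
    have e1 : T * T ^ (a / 4) = T ^ (((5 : ℝ) - r) / (4 - r)) := by
      rw [show T * T ^ (a / 4) = T ^ (1 : ℝ) * T ^ (a / 4) by rw [rpow_one], ← rpow_add hT0]
      congr 1
      rw [ha]; field_simp; ring
    have e2 : log T ^ (b / 4) * log T ^ 2 = log T ^ ((8 : ℝ) / (4 - r)) := by
      rw [show (log T ^ 2 : ℝ) = log T ^ (2 : ℝ) by rw [← rpow_natCast]; norm_num,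
        ← rpow_add (by linarith : 0 < log T)]
      congr 1
      rw [hb]; field_simp; ring
    calc T * (T ^ (a / 4) * log T ^ (b / 4)) * log T ^ 2
        = (T * T ^ (a / 4)) * (log T ^ (b / 4) * log T ^ 2) := by ring
      _ = _ := by rw [e1, e2]
  have hpos1 : 0 ≤ lam ^ 3 * γ₂ ^ (-(1 / 4 : ℝ)) := by positivity
  have hpos2 : 0 ≤ T ^ (a / 4) * log T ^ (b / 4) := by positivity
  calc T * L * log L ^ 2 ≤ T * (lam ^ 3 * γ₂ ^ (-(1 / 4 : ℝ)) * (T ^ (a / 4) * log T ^ (b / 4))) *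
        (64 * log T ^ 2) := by
        apply mul_le_mul (mul_le_mul_of_nonneg_left hLle hT0.le) hlogL2 (by positivity)
        positivity
    _ = 64 * lam ^ 3 * γ₂ ^ (-(1 / 4 : ℝ)) * (T * (T ^ (a / 4) * log T ^ (b / 4)) * log T ^ 2) := by
        ring
    _ = _ := by rw [hprod]

/-- **The last step of the induction** ("`t(J)^{4/(5−r)} (log t(J))^{(8r−8)/(5−r)}
≤ λ¹¹ T^{4/(4−r)} (log T)^{8r/(4−r)}`", p. 45): for `2 ≤ r ≤ 3`, `λ ≥ 1`, `T ≥ e` with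
`log T ≥ 5 log λ`, and `T' = λ⁵ T^{(5−r)/(4−r)} (log T)^{8/(4−r)}`,
`f_{r−1}(T') = T'^{4/(5−r)} (log T')^{8(r−1)/(5−r)} ≤ 12⁸ λ^{10} f_r(T)`.
[cite: NesterenkoPhilippon2001, Ch. 3 §5, last display of p. 45] -/
theorem f_prev_le {r : ℕ} (hr2 : 2 ≤ r) (hr : r ≤ 3) {T lam : ℝ} (hlam : 1 ≤ lam) (hT : exp 1 ≤ T)
    (hlogT : 5 * log lam ≤ log T) :
    let T' := lam ^ 5 * (T ^ (((5 : ℝ) - r) / (4 - r)) * log T ^ ((8 : ℝ) / (4 - r)))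
    T' ^ ((4 : ℝ) / (4 - (r - 1 : ℕ))) * log T' ^ ((8 : ℝ) * (r - 1 : ℕ) / (4 - (r - 1 : ℕ))) ≤
      12 ^ 8 * lam ^ 10 * (T ^ ((4 : ℝ) / (4 - r)) * log T ^ ((8 : ℝ) * r / (4 - r))) := by
  intro T'
  have h4 := four_sub_pos hr
  have hr' : (2 : ℝ) ≤ r := by exact_mod_cast hr2
  have hr3 : (r : ℝ) ≤ 3 := by exact_mod_cast hr
  have h5 : (0 : ℝ) < 5 - r := by linarith
  have hcast : ((r - 1 : ℕ) : ℝ) = r - 1 := by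
    rw [Nat.cast_sub (by omega)]; norm_num
  rw [hcast]
  have e4 : (4 : ℝ) - (r - 1) = 5 - r := by ring
  rw [e4]
  have hT0 : 0 < T := lt_of_lt_of_le (exp_pos 1) hT
  have hT1 : 1 ≤ T := le_trans (by linarith [add_one_le_exp (1 : ℝ)]) hT
  have hlT : 1 ≤ log T := one_le_log_of_exp_one_le hT
  have hlam0 : 0 < lam := by linarith
  have hllam : 0 ≤ log lam := log_nonneg hlam
  set g : ℝ := T ^ (((5 : ℝ) - r) / (4 - r)) * log T ^ ((8 : ℝ) / (4 - r)) with hg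
  have hTg : T ≤ g := le_g hr hT
  have hg0 : 0 < g := by linarith
  have hT'ge : T ≤ T' := by
    have : g ≤ lam ^ 5 * g := le_mul_of_one_le_left hg0.le (one_le_pow₀ hlam)
    exact hTg.trans this
  have hT'0 : 0 < T' := by linarith
  -- `log T' ≤ 12 log T`
  have hlogT' : log T' ≤ 12 * log T := by
    have e1 : log T' = 5 * log lam + (((5 : ℝ) - r) / (4 - r)) * log T +
        ((8 : ℝ) / (4 - r)) * log (log T) := by
      show log (lam ^ 5 * g) = _
      rw [log_mul (by positivity) hg0.ne', log_pow, hg,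
        log_mul (rpow_pos_of_pos hT0 _).ne' (rpow_pos_of_pos (by linarith) _).ne',
        log_rpow hT0, log_rpow (by linarith)]
      push_cast
      ring
    have hll : log (log T) ≤ log T := by
      have := log_le_sub_one_of_pos (show 0 < log T by linarith); linarith
    have hll0 : 0 ≤ log (log T) := log_nonneg hlT
    have hc1 : ((5 : ℝ) - r) / (4 - r) ≤ 3 := by rw [div_le_iff₀ h4]; nlinarith
    have hc2 : (8 : ℝ) / (4 - r) ≤ 8 := by rw [div_le_iff₀ h4]; nlinarith
    have hc1' : 0 ≤ ((5 : ℝ) - r) / (4 - r) := by positivity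
    rw [e1]
    nlinarith [mul_le_mul hc1 (le_refl (log T)) (by linarith) (by norm_num),
      mul_le_mul hc2 hll hll0 (by norm_num)]
  have hlogT'1 : 1 ≤ log T' := hlT.trans (log_le_log hT0 hT'ge)
  -- first factor: `T'^{4/(5−r)} = λ^{20/(5−r)} T^{4/(4−r)} (log T)^{32/((4−r)(5−r))}`
  have e1 : T' ^ ((4 : ℝ) / (5 - r)) = lam ^ ((20 : ℝ) / (5 - r)) *
      (T ^ ((4 : ℝ) / (4 - r)) * log T ^ ((32 : ℝ) / ((4 - r) * (5 - r)))) := by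
    show (lam ^ 5 * g) ^ ((4 : ℝ) / (5 - r)) = _
    rw [mul_rpow (by positivity) hg0.le, hg, mul_rpow (rpow_nonneg hT0.le _)
      (rpow_nonneg (by linarith) _), ← rpow_mul hT0.le, ← rpow_mul (by linarith : 0 ≤ log T),
      show (lam ^ 5 : ℝ) = lam ^ (5 : ℝ) by rw [← rpow_natCast]; norm_num, ← rpow_mul hlam0.le]
    congr 1
    · congr 1; field_simp; ring
    · congr 1
      · congr 1; field_simp
      · congr 1; field_simp; norm_num
  -- second factor: `(log T')^{8(r-1)/(5-r)} ≤ 12^8 (log T)^{8(r-1)/(5-r)}`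
  have hexp : 0 ≤ (8 : ℝ) * (r - 1) / (5 - r) := div_nonneg (by nlinarith) h5.le
  have hexp8 : (8 : ℝ) * (r - 1) / (5 - r) ≤ 8 := by rw [div_le_iff₀ h5]; nlinarith
  have e2 : log T' ^ ((8 : ℝ) * (r - 1) / (5 - r)) ≤
      12 ^ 8 * log T ^ ((8 : ℝ) * (r - 1) / (5 - r)) := by
    calc log T' ^ ((8 : ℝ) * (r - 1) / (5 - r)) ≤ (12 * log T) ^ ((8 : ℝ) * (r - 1) / (5 - r)) :=
          rpow_le_rpow (by linarith) hlogT' hexp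
      _ = 12 ^ ((8 : ℝ) * (r - 1) / (5 - r)) * log T ^ ((8 : ℝ) * (r - 1) / (5 - r)) :=
          mul_rpow (by norm_num) (by linarith)
      _ ≤ 12 ^ (8 : ℝ) * log T ^ ((8 : ℝ) * (r - 1) / (5 - r)) := by
          apply mul_le_mul_of_nonneg_right _ (by positivity)
          exact rpow_le_rpow_of_exponent_le (by norm_num) hexp8
      _ = 12 ^ 8 * log T ^ ((8 : ℝ) * (r - 1) / (5 - r)) := by norm_num
  -- `λ^{20/(5-r)} ≤ λ^{10}`
  have e3 : lam ^ ((20 : ℝ) / (5 - r)) ≤ lam ^ 10 := by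
    have : lam ^ ((20 : ℝ) / (5 - r)) ≤ lam ^ ((10 : ℕ) : ℝ) := by
      refine rpow_le_rpow_of_exponent_le hlam ?_
      rw [div_le_iff₀ h5]; push_cast; nlinarith
    rwa [rpow_natCast] at this
  -- the exponent identity `32/((4-r)(5-r)) + 8(r-1)/(5-r) = 8r/(4-r)`
  have e5 : log T ^ ((32 : ℝ) / ((4 - r) * (5 - r))) * log T ^ ((8 : ℝ) * (r - 1) / (5 - r)) =
      log T ^ ((8 : ℝ) * r / (4 - r)) := by
    rw [← rpow_add (by linarith : 0 < log T)]
    congr 1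
    field_simp
    ring
  rw [e1]
  set A : ℝ := T ^ ((4 : ℝ) / (4 - r)) with hA
  set B : ℝ := log T ^ ((32 : ℝ) / ((4 - r) * (5 - r))) with hB
  set C : ℝ := log T ^ ((8 : ℝ) * (r - 1) / (5 - r)) with hC
  have hA0 : 0 ≤ A := by positivity
  have hB0 : 0 ≤ B := by positivity
  have hC0 : 0 ≤ C := by positivity
  calc lam ^ ((20 : ℝ) / (5 - r)) * (A * B) * log T' ^ ((8 : ℝ) * (r - 1) / (5 - r))
      ≤ lam ^ 10 * (A * B) * (12 ^ 8 * C) := by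
        apply mul_le_mul (mul_le_mul_of_nonneg_right e3 (by positivity)) e2 (by positivity)
        positivity
    _ = 12 ^ 8 * lam ^ 10 * (A * (B * C)) := by ring
    _ = 12 ^ 8 * lam ^ 10 * (A * log T ^ ((8 : ℝ) * r / (4 - r))) := by rw [hB, hC, e5]

end Literature.Barriers.Schanuel

end
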